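import Summits.QuantumFields.YangMills.Theorems.BalabanUVNodesN11NoExpansionStepSpecification
import Summits.QuantumFields.YangMills.Theorems.BalabanUVNodesN11NoExpansionStepSpecificationOfCoercive
import Summits.QuantumFields.YangMills.Theorems.BalabanUVNodesN11Sect3SupplyDefs

/-!
# DAG node N11 — THE GAUSSIAN CERTIFICATE CLASS: a v1.7 parameter whose history-indexed residual 𝐓-weight slot has the certificate's `ζ0` (dag-n11-d's
# `ZhPinOfRecord₁₃`) and, as `quad`, THE GAUSSIAN OF THE INTEGRATED VARIABLES `quad_j(Λ′)(ω) = Σ_{b ∈ bonds_j(Λ′ᶜ ∩ Ω_{j+1})} ‖A_j(b)‖²` satisfies EVERY residual row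
# of dag-n11-d's no-expansion 𝐓-step specification at EVERY no-expansion history — so there door (d3) closes the 𝐓-image clause modulo def-T's operand rows ONLY

HEADER — WORK-UNIT METADATA.  Cell `pub-ymgap`, YM-PLAN Track A (D-0062 ∕ D-0149 width seats), seat `pub-ymgap-dag-n11-w1` (g0; WIDTH SEAT 1 of 4 on NODE n11 [B14]),
route `BalabanUVNodes` rev 25, item K1⁷ `StabilityBAtRecordR13SepCoPH` = stmt-QuantumFields-20542 (helper, `--kind proof --supports 20542 --as helper`, count-neutral).
[III] = [Balaban1988Convergent], [I] = [Balaban1987RG1].  Composition of dag-n11-d's p583082 ★★★ `…N11NoExpansionStepSpecification.exists_local_witness_clause_succ_of_sLaw₁₃CoPH_of_rows`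
(the row list), dag-n11-w4's `…N11AFibreDominationOfCoercive.afibre_rows_adm_of_coercive` (K0b rows ⟸ coercivity), dag-n11-d's certificate faces
(`…N11RePinnedParamDefs`: `zhAt_rePinH_ζ0_univ_pairCfgAt`, `zhAt_rePinH_eq_init_of_Omega_empty`, `zhUnity_rePinH`; `…N11RePinnedOldBranchMeasurable.measurable_zhAt_ζ0_rePinH_of_provisos`;
`…N11HistoryPinnedResidualDefs.laws_∕localLaws_ZhPinOfRecord₁₃`) and this seat's `…N11AFibreDominationRow` §3 (WHY: at the certificate `rePinH θ` — `quad ≡ 0` — the K0b row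
FAILS at every thin region; the Gaussian `quad` removes exactly that obstruction and costs none of the other rows).

THE CLASS (two hypotheses on `θ : Stage13HParams`, no definition): `hζ : ∀ p n Ω Λ, (θ.Zh p n Ω Λ).ζ0 = (ZhPinOfRecord₁₃ θ.toStage13Params p Ω Λ).ζ0` (the certificate's
residual factor) and `hq : ∀ p n Ω Λ j Λ′ ω, (θ.Zh p n Ω Λ).quad j Λ′ ω = Σ_{b ∈ bonds_j(Λ′ᶜ ∩ Ω (j+1))} ‖(ω j).2 b‖²` ([I]'s form SHAPE on the fields of `Z_{j+1} ∩ Ω_{j+1}` with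
unit coercivity constant — a range value, NOT node00-def-K0b's value of record, which is `⟨A_j, (C*Δ^{(j)}C − C*Δ^{(j)}CC^{(j)}(Λ_{j+1})C*Δ^{(j)}C) A_j⟩` at the background).
CAVEAT (dag-n11-w4's word, bus 2026-08-27T23:53Z): like `rePinH`, a certificate with a RANGE value of `quad` serves the NO-EXPANSION analysis only — the expansion children
(`Sect3SupplyAt`, [III] §3) see print's `𝒬_j`; the class is a bookkeeping device for door (d3), not a claim about the value of record.

WHAT THIS FILE PROVES (0 `sorry`, 0 `def`; nothing of Bałaban asserted).
§1 THE ROWS, one by one, for every `θ` of the class and every history: `zhAt_ζ0_eq_rePinH`, `zhAt_quad_apply`, `zhUnity_of_gaussCert`, ★ `coercive_of_gaussCert` (c = 1: the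
   A-fibre bonds of `init s′` are among those of `s′`), (P) `prefix_agree_of_gaussCert`, (V) `ζ0_pin_of_gaussCert`, `quad_empty_pairCfgAt_of_gaussCert` (the two-scale
   configurations have zero fluctuation variables), `quad_local_of_gaussCert`, `measurable_ζ0_of_gaussCert`, `measurable_quad_of_gaussCert`.
§2 ★★★ `exists_local_witness_clause_succ_of_sLaw₁₃CoPH_of_gaussCert`: for `θ` of the class with core provisos, `k < K`, `1 ≤ M`: from `SLaw₁₃CoPH θ p k` one k-local
   law-abiding witness such that AT EVERY NO-EXPANSION HISTORY `s′` the 𝐓-image clause holds as soon as def-T's two operand rows hold for THIS witness — dag-n11-d's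
   specification with ALL NINE residual rows DISCHARGED (no thin-region exception, unlike the certificate `rePinH θ`).  ★★ `noExpansionTStepAt_of_gaussCert_of_operandRows`:
   hence dag-n11-e's deliverable `NoExpansionTStepAt θ p k` from the operand rows alone; ★★★ `…_of_gaussCert_of_termRows`: the same in def-T's term-row grammar
   (dag-n11-w4's edition 2 p587736 of dag-n11-d's p586165): six term rows ONLY.
§3 ★★ `exists_gaussCert_of_antecedent` (A6 + transfer): every parameter carrying the K⁷ antecedent (`Provisos₁₃SepCoPH ∧ (ZhUnity ∧ SlotsNondegenerate₁₃) ∧ Admissible`)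
   yields one of the class carrying it too (replace the slot `Zh`; every antecedent row reads the Stage-13R part, `zhLaws`∕`zhLocal` read `ζ0` only) — exactly as
   dag-n11-d's `antecedent_rePinH`, so the line of record may re-pin to the Gaussian certificate at no cost.

HONEST FRAMING.  Helper lane of K1⁷; kernel bookkeeping over accepted declarations; nothing of Bałaban's estimates asserted; no law of record edited or posited (the class
is a HYPOTHESIS on `θ`; the K⁷ texts quantify over `θ`).  The operand rows (def-T ∕ def-R ∕ dag-n11-d INTENT-11) and [III] §3's supply stay DISPLAYED.  N11 NOT discharged;
K1⁷ NOT closed; counts unmoved (typed 28∕28 · discharged 5∕27).  R4 closes only the conditional finite-𝕋⁴ rung `BalabanLadder.UV` of one programme at fixed `ε = L^{−K}` —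
NOT ℝ⁴, NOT OS, NOT a mass gap, NOT Clay.  No `sorry`, `axiom`, `instance`, `notation`.
Sources (SHAPE only): [III] Theorem p.245, Thm 1 p.262, (2.18) p.257, (2.21) p.258, (3.16)–(3.21) pp.268–269, (3.23)–(3.25) p.270; [I] (1.4)–(1.5) pp.260–261.
-/

noncomputable section

open MeasureTheory
open scoped BigOperators ENNReal NNReal Matrix.Norms.L2Operator

namespace Summit.QuantumFields.YangMills.Theorems.BalabanUVNodesN11GaussianCertificateRows

open Literature.MathematicalPhysics.QuantumFieldTheory.Balaban1983to89 T4Continuum Node00 Node00.Tk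
open B10Eq42TorusConstraint (bondsIn)
open BalabanUVNodesN11RePinnedParamDefs
open BalabanUVNodesN11HistoryPinnedResidualDefs (ZhPinOfRecord₁₃ laws_ZhPinOfRecord₁₃ localLaws_ZhPinOfRecord₁₃)
open BalabanUVNodesN11RePinnedOldBranchMeasurable (measurable_zhAt_ζ0_rePinH_of_provisos)
open BalabanUVNodesN11FluctTruncationDefs (IsFluctLocal)
open BalabanUVNodesN11Sect3SupplyDefs (NoExpansionTStepAt)
open BalabanUVNodesN11NoExpansionStepSpecification (exists_local_witness_clause_succ_of_sLaw₁₃CoPH_of_rows)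
open BalabanUVNodesN11AFibreDominationOfCoercive (afibre_rows_adm_of_coercive)
open BalabanUVNodesN11NoExpansionStepSpecificationOfCoercive (exists_local_witness_clause_succ_of_sLaw₁₃CoPH_of_coercive_of_termRows)
open B15DeterminingSets (MSField)

variable {F : T4Family} {N : ℕ} [NeZero N]

/-! ## §1  The residual rows of the specification hold for every parameter of the Gaussian certificate class -/

section Rows

variable (θ : Stage13HParams F N) (p : B12.RunParams)

/-- The residual factor serving any history IS the certificate's (`hζ`). [cite: Balaban1988Convergent, (3.16)–(3.20) pp.268–269 (bookkeeping)] -/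
theorem zhAt_ζ0_eq_rePinH (hζ : ∀ (p : B12.RunParams) (n : ℕ) (Ω Λ : ℕ → Set (Site (F.P p.K) 0)), (θ.Zh p n Ω Λ).ζ0 = (ZhPinOfRecord₁₃ θ.toStage13Params p Ω Λ).ζ0)
    {n : ℕ} (s : SeqOfRecord F θ.ν θ.τ9.M (gOfRecord₁₃ F N θ.toStage13Params p) p.K n) : (θ.zhAt p s).ζ0 = ((rePinH θ).zhAt p s).ζ0 :=
  hζ p n s.Ω s.Λ

/-- The form serving any history is the Gaussian of the integrated variables (`hq`). [cite: Balaban1988Convergent, (2.21) p.258 (bookkeeping)] -/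
theorem zhAt_quad_apply
    (hq : ∀ (p : B12.RunParams) (n : ℕ) (Ω Λ : ℕ → Set (Site (F.P p.K) 0)) (j : ℕ) (Λ' : Set (Site (F.P p.K) 0)) (ω : MultiCfg (F.P p.K) (SU N) (FluctV N)),
      (θ.Zh p n Ω Λ).quad j Λ' ω = ∑ b ∈ (Set.toFinite (bondsIn j (Λ'ᶜ ∩ Ω (j + 1)))).toFinset, ‖(ω j).2 b‖ ^ 2)
    {n : ℕ} (s : SeqOfRecord F θ.ν θ.τ9.M (gOfRecord₁₃ F N θ.toStage13Params p) p.K n) (j : ℕ) (Λ' : Set (Site (F.P p.K) 0)) (ω : MultiCfg (F.P p.K) (SU N) (FluctV N)) :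
    (θ.zhAt p s).quad j Λ' ω = ∑ b ∈ (Set.toFinite (bondsIn j (Λ'ᶜ ∩ s.Ω (j + 1)))).toFinset, ‖(ω j).2 b‖ ^ 2 :=
  hq p n s.Ω s.Λ j Λ' ω

/-- **PRINT'S PARTITION OF UNITY** holds in the class (the certificate's `ζ0`, dag-n11-d's `zhUnity_rePinH`). [cite: Balaban1988Convergent, (3.16)–(3.20) pp.268–269] -/
theorem zhUnity_of_gaussCert (hζ : ∀ (p : B12.RunParams) (n : ℕ) (Ω Λ : ℕ → Set (Site (F.P p.K) 0)), (θ.Zh p n Ω Λ).ζ0 = (ZhPinOfRecord₁₃ θ.toStage13Params p Ω Λ).ζ0) :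
    θ.ZhUnity F N := by
  intro p n Ω Λ j ω
  rw [hζ p n Ω Λ]
  exact zhUnity_rePinH (θ := θ) p n Ω Λ j ω

/-- **★ COERCIVITY WITH CONSTANT `1` AT EVERY HISTORY AND GENERATION**: the A-fibre bonds of `init s′` (in `Λ_{j+1}(init s′)ᶜ ∩ Ω_{j+1}(init s′)`) are among the bonds of
`Λ_{j+1}(init s′)ᶜ ∩ Ω_{j+1}(s′)` summed by the Gaussian serving `s′` (`Ω_{j+1}(init s′) ⊆ Ω_{j+1}(s′)`: equal below the top, empty above) — the hypothesis `hcoer` of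
dag-n11-w4's `afibre_rows_adm_of_coercive`. [cite: Balaban1988Convergent, (2.21) p.258, (2.1) p.254; Balaban1987RG1, (1.4)–(1.5) pp.260–261] -/
theorem coercive_of_gaussCert
    (hq : ∀ (p : B12.RunParams) (n : ℕ) (Ω Λ : ℕ → Set (Site (F.P p.K) 0)) (j : ℕ) (Λ' : Set (Site (F.P p.K) 0)) (ω : MultiCfg (F.P p.K) (SU N) (FluctV N)),
      (θ.Zh p n Ω Λ).quad j Λ' ω = ∑ b ∈ (Set.toFinite (bondsIn j (Λ'ᶜ ∩ Ω (j + 1)))).toFinset, ‖(ω j).2 b‖ ^ 2)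
    {k : ℕ} (s : SeqOfRecord F θ.ν θ.τ9.M (gOfRecord₁₃ F N θ.toStage13Params p) p.K (k + 1)) (j : ℕ) :
    ∃ c : ℝ, 0 < c ∧ ∀ ω : MultiCfg (F.P p.K) (SU N) (FluctV N),
      c * ∑ b ∈ (Set.toFinite (bondsIn j ((s.init.Λ (j + 1))ᶜ ∩ s.init.Ω (j + 1)))).toFinset, ‖(ω j).2 b‖ ^ 2 ≤ (θ.zhAt p s).quad j (s.init.Λ (j + 1)) ω := by
  refine ⟨1, one_pos, fun ω => ?_⟩
  rw [one_mul, zhAt_quad_apply θ p hq]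
  have hΩ : s.init.Ω (j + 1) ⊆ s.Ω (j + 1) := by
    by_cases hj : j + 1 ≤ k
    · exact (seq_init_Ω_of_le s hj).le
    · rw [s.init.Ω_off (j + 1) (fun h => hj h.2)]; exact Set.empty_subset _
  refine Finset.sum_le_sum_of_subset_of_nonneg (fun b hb => ?_) fun _ _ _ => by positivity
  rw [Set.Finite.mem_toFinset] at hb ⊢
  exact B10Eq42TorusConstraint.bondsIn_mono (Set.inter_subset_inter_right _ hΩ) hb

/-- **(P) PREFIX AGREEMENT** at a no-expansion history: `ζ0` by dag-n11-d's `zhAt_rePinH_eq_init_of_Omega_empty`, `quad_j` (`j < k`) because it reads `Ω_{j+1}` only.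
[cite: Balaban1988Convergent, p.257, (2.1) p.254 (bookkeeping)] -/
theorem prefix_agree_of_gaussCert
    (hζ : ∀ (p : B12.RunParams) (n : ℕ) (Ω Λ : ℕ → Set (Site (F.P p.K) 0)), (θ.Zh p n Ω Λ).ζ0 = (ZhPinOfRecord₁₃ θ.toStage13Params p Ω Λ).ζ0)
    (hq : ∀ (p : B12.RunParams) (n : ℕ) (Ω Λ : ℕ → Set (Site (F.P p.K) 0)) (j : ℕ) (Λ' : Set (Site (F.P p.K) 0)) (ω : MultiCfg (F.P p.K) (SU N) (FluctV N)),
      (θ.Zh p n Ω Λ).quad j Λ' ω = ∑ b ∈ (Set.toFinite (bondsIn j (Λ'ᶜ ∩ Ω (j + 1)))).toFinset, ‖(ω j).2 b‖ ^ 2)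
    {k : ℕ} (s : SeqOfRecord F θ.ν θ.τ9.M (gOfRecord₁₃ F N θ.toStage13Params p) p.K (k + 1)) (hΩ : s.Ω (k + 1) = ∅) :
    ∀ j, j < k → (θ.zhAt p s).ζ0 j = (θ.zhAt p s.init).ζ0 j ∧ (θ.zhAt p s).quad j = (θ.zhAt p s.init).quad j := by
  intro j hj
  constructor
  · rw [zhAt_ζ0_eq_rePinH θ p hζ s, zhAt_ζ0_eq_rePinH θ p hζ s.init, zhAt_rePinH_eq_init_of_Omega_empty θ p s hΩ]
  · funext Λ' ω
    rw [zhAt_quad_apply θ p hq, zhAt_quad_apply θ p hq, seq_init_Ω_of_le s (Nat.succ_le_of_lt hj)]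

/-- **(V) THE GENERATION-`k` PIN** at a no-expansion history (the certificate's `ζ0`; dag-n11-d's `zhAt_rePinH_ζ0_univ_pairCfgAt`).
[cite: Balaban1988Convergent, (2.21) p.258, (3.16) p.268, (3.24)–(3.25) p.270] -/
theorem ζ0_pin_of_gaussCert
    (hζ : ∀ (p : B12.RunParams) (n : ℕ) (Ω Λ : ℕ → Set (Site (F.P p.K) 0)), (θ.Zh p n Ω Λ).ζ0 = (ZhPinOfRecord₁₃ θ.toStage13Params p Ω Λ).ζ0)
    {k : ℕ} (hk : k < p.K) (s : SeqOfRecord F θ.ν θ.τ9.M (gOfRecord₁₃ F N θ.toStage13Params p) p.K (k + 1)) (hΩ : s.Ω (k + 1) = ∅)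
    (V' : GaugeField (F.P p.K) (k + 1) (SU N)) (U₀ : GaugeField (F.P p.K) k (SU N)) :
    (θ.zhAt p s).ζ0 k Set.univ (pairCfgAt (V := FluctV N) k V' U₀) =
      chiSeqOfRecord F N θ.ν θ.τ9.M (gOfRecord₁₃ F N θ.toStage13Params p) p.K k s.init U₀ *
        wOfRecord₉ F N θ.toStage9Params p (gOfRecord₁₃ F N θ.toStage13Params p) k s U₀ ((avOfRecord F N p.K k).avg U₀) := by
  rw [zhAt_ζ0_eq_rePinH θ p hζ s]
  exact zhAt_rePinH_ζ0_univ_pairCfgAt θ p hk s hΩ V' U₀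

/-- **`quad_k(∅) = 0` ON THE TWO-SCALE CONFIGURATIONS**: they have zero fluctuation variables (def-T's `pairCfgAt_snd`). [cite: Balaban1988Convergent, (2.21)–(2.22) p.258] -/
theorem quad_empty_pairCfgAt_of_gaussCert
    (hq : ∀ (p : B12.RunParams) (n : ℕ) (Ω Λ : ℕ → Set (Site (F.P p.K) 0)) (j : ℕ) (Λ' : Set (Site (F.P p.K) 0)) (ω : MultiCfg (F.P p.K) (SU N) (FluctV N)),
      (θ.Zh p n Ω Λ).quad j Λ' ω = ∑ b ∈ (Set.toFinite (bondsIn j (Λ'ᶜ ∩ Ω (j + 1)))).toFinset, ‖(ω j).2 b‖ ^ 2)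
    {k : ℕ} (s : SeqOfRecord F θ.ν θ.τ9.M (gOfRecord₁₃ F N θ.toStage13Params p) p.K (k + 1))
    (V' : GaugeField (F.P p.K) (k + 1) (SU N)) (U₀ : GaugeField (F.P p.K) k (SU N)) :
    (θ.zhAt p s).quad k ∅ (pairCfgAt (V := FluctV N) k V' U₀) = 0 := by
  rw [zhAt_quad_apply θ p hq]
  refine Finset.sum_eq_zero fun b _ => ?_
  rw [pairCfgAt_snd]
  simp

/-- **`k`-LOCALITY OF `quad_j`**, `j < k`: it reads the generation-`j` fluctuation variables only. [cite: Balaban1988Convergent, (2.21) p.258 (bookkeeping)] -/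
theorem quad_local_of_gaussCert
    (hq : ∀ (p : B12.RunParams) (n : ℕ) (Ω Λ : ℕ → Set (Site (F.P p.K) 0)) (j : ℕ) (Λ' : Set (Site (F.P p.K) 0)) (ω : MultiCfg (F.P p.K) (SU N) (FluctV N)),
      (θ.Zh p n Ω Λ).quad j Λ' ω = ∑ b ∈ (Set.toFinite (bondsIn j (Λ'ᶜ ∩ Ω (j + 1)))).toFinset, ‖(ω j).2 b‖ ^ 2)
    {k : ℕ} (s : SeqOfRecord F θ.ν θ.τ9.M (gOfRecord₁₃ F N θ.toStage13Params p) p.K (k + 1)) :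
    ∀ j, j < k → ∀ ω ω' : MultiCfg (F.P p.K) (SU N) (FluctV N), (∀ i, i ≤ k → ω i = ω' i) →
      (θ.zhAt p s).quad j (s.init.Λ (j + 1)) ω = (θ.zhAt p s).quad j (s.init.Λ (j + 1)) ω' := by
  intro j hj ω ω' hωω'
  rw [zhAt_quad_apply θ p hq, zhAt_quad_apply θ p hq, hωω' j hj.le]

/-- **MEASURABILITY OF `ζ0`** in the class from the core provisos (dag-n11-d's `measurable_zhAt_ζ0_rePinH_of_provisos`). [cite: Balaban1988Convergent, (3.16)–(3.20) pp.268–269 (bookkeeping)] -/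
theorem measurable_ζ0_of_gaussCert
    (hζ : ∀ (p : B12.RunParams) (n : ℕ) (Ω Λ : ℕ → Set (Site (F.P p.K) 0)), (θ.Zh p n Ω Λ).ζ0 = (ZhPinOfRecord₁₃ θ.toStage13Params p Ω Λ).ζ0)
    (h : θ.Provisos₁₃CoPH F N) {n : ℕ} (s : SeqOfRecord F θ.ν θ.τ9.M (gOfRecord₁₃ F N θ.toStage13Params p) p.K n) (j : ℕ) (Y : Set (Site (F.P p.K) 0)) :
    Measurable ((θ.zhAt p s).ζ0 j Y) := by
  rw [zhAt_ζ0_eq_rePinH θ p hζ s]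
  exact measurable_zhAt_ζ0_rePinH_of_provisos θ p h s j Y

/-- **MEASURABILITY OF `quad_j(Λ′)`** in the class: a finite sum of squared norms of coordinates. [cite: Balaban1988Convergent, (2.21) p.258 (bookkeeping)] -/
theorem measurable_quad_of_gaussCert
    (hq : ∀ (p : B12.RunParams) (n : ℕ) (Ω Λ : ℕ → Set (Site (F.P p.K) 0)) (j : ℕ) (Λ' : Set (Site (F.P p.K) 0)) (ω : MultiCfg (F.P p.K) (SU N) (FluctV N)),
      (θ.Zh p n Ω Λ).quad j Λ' ω = ∑ b ∈ (Set.toFinite (bondsIn j (Λ'ᶜ ∩ Ω (j + 1)))).toFinset, ‖(ω j).2 b‖ ^ 2)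
    {n : ℕ} (s : SeqOfRecord F θ.ν θ.τ9.M (gOfRecord₁₃ F N θ.toStage13Params p) p.K n) (j : ℕ) (Λ' : Set (Site (F.P p.K) 0)) :
    Measurable ((θ.zhAt p s).quad j Λ') := by
  have e : (θ.zhAt p s).quad j Λ' = fun ω => ∑ b ∈ (Set.toFinite (bondsIn j (Λ'ᶜ ∩ s.Ω (j + 1)))).toFinset, ‖(ω j).2 b‖ ^ 2 :=
    funext fun ω => zhAt_quad_apply θ p hq s j Λ' ω
  rw [e]
  refine Finset.measurable_sum _ fun b _ => ?_
  have hb : Measurable fun ω : MultiCfg (F.P p.K) (SU N) (FluctV N) => (ω j).2 b :=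
    (measurable_pi_apply b).comp (measurable_snd.comp (measurable_pi_apply j))
  exact (hb.norm).pow_const 2

end Rows

/-! ## §2  ★★★ Hence the no-expansion 𝐓-step for the class: ALL residual rows discharged, def-T's operand rows only -/

section Step

variable (θ : Stage13HParams F N) (p : B12.RunParams)

/-- **★★★ THE NO-EXPANSION 𝐓-STEP FOR THE GAUSSIAN CERTIFICATE CLASS, WITNESS FIRST, AT EVERY NO-EXPANSION HISTORY, MODULO def-T's OPERAND ROWS ONLY**: dag-n11-d's
specification `exists_local_witness_clause_succ_of_sLaw₁₃CoPH_of_rows` with its residual rows (P), (V), `quad_k(∅) = 0`, locality, measurability DISCHARGED by §1 and its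
(K0b) A-fibre domination rows DISCHARGED by dag-n11-w4's `afibre_rows_adm_of_coercive` through §1's unit coercivity — no thin-region exception (contrast
`…N11AFibreDominationRow.not_rows_rePinH_of_noCube` at the certificate `rePinH θ`). [cite: Balaban1988Convergent, Theorem p.245, Thm 1 p.262, (3.24)–(3.25) p.270, (2.18) p.257, (2.21)–(2.23) p.258, (3.16)–(3.21) pp.268–269] -/
theorem exists_local_witness_clause_succ_of_sLaw₁₃CoPH_of_gaussCert
    (hζ : ∀ (p : B12.RunParams) (n : ℕ) (Ω Λ : ℕ → Set (Site (F.P p.K) 0)), (θ.Zh p n Ω Λ).ζ0 = (ZhPinOfRecord₁₃ θ.toStage13Params p Ω Λ).ζ0)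
    (hq : ∀ (p : B12.RunParams) (n : ℕ) (Ω Λ : ℕ → Set (Site (F.P p.K) 0)) (j : ℕ) (Λ' : Set (Site (F.P p.K) 0)) (ω : MultiCfg (F.P p.K) (SU N) (FluctV N)),
      (θ.Zh p n Ω Λ).quad j Λ' ω = ∑ b ∈ (Set.toFinite (bondsIn j (Λ'ᶜ ∩ Ω (j + 1)))).toFinset, ‖(ω j).2 b‖ ^ 2)
    (h : θ.Provisos₁₃CoPH F N) {k : ℕ} (hk : k < p.K) (hM : 1 ≤ θ.τ9.M) (hS : SLaw₁₃CoPH F N θ p k) :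
    ∃ (t : SeqOfRecord F θ.ν θ.τ9.M (gOfRecord₁₃ F N θ.toStage13Params p) p.K k → Sect2.TermValues (F.P p.K) (MatA N) (FluctV N) θ.τ9.M)
      (Ek : SeqOfRecord F θ.ν θ.τ9.M (gOfRecord₁₃ F N θ.toStage13Params p) p.K k → ℝ),
      HasSect2FormAtZS F N (FluctV N) p.K (settingOfRecord₁₃ F N θ.toStage13Params p) k (θ.rzAt p) (WtOfRecord₁₃H F N θ p)
          (UbgOfRecord₁₃CoP F N θ.toStage13Params p k)
          (fun s₀ t₀ => Sect2.LawsRT (sect2TowerOfRecord F N (FluctV N) p.K (settingOfRecord₁₃ F N θ.toStage13Params p) (θ.rzAt p s₀) s₀ t₀)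
            (settingOfRecord₁₃ F N θ.toStage13Params p).lf k)
          (slotsOfRecord F N θ.ν θ.τ9 (EOfRecord₁₃ F N θ.toStage13Params) (wOfRecord₉ F N θ.toStage9Params) θ.ppSel p
            (gOfRecord₁₃ F N θ.toStage13Params p) k) t Ek ∧
      (∀ s₀, IsFluctLocal k (t s₀)) ∧
      ∀ (s : SeqOfRecord F θ.ν θ.τ9.M (gOfRecord₁₃ F N θ.toStage13Params p) p.K (k + 1)), s.Ω (k + 1) = ∅ →
        (∀ S ∈ admSOfRecord F θ.ν θ.τ9.M (gOfRecord₁₃ F N θ.toStage13Params p) p.K k s.init,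
          Measurable (fun ω : MultiCfg (F.P p.K) (SU N) (FluctV N) =>
            sect2Operand F N (FluctV N) p.K (settingOfRecord₁₃ F N θ.toStage13Params p) (θ.rzAt p s.init) s.init (t s.init) (Ek s.init)
                (UbgOfRecord₁₃CoP F N θ.toStage13Params p k s.init) (S, fun j => (ω j).2) (fun j => (ω j).1)) ∧
          ∃ CΦ : ℝ, ∀ a U, sect2Operand F N (FluctV N) p.K (settingOfRecord₁₃ F N θ.toStage13Params p) (θ.rzAt p s.init) s.init (t s.init) (Ek s.init)
                (UbgOfRecord₁₃CoP F N θ.toStage13Params p k s.init) a U ≤ CΦ) →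
        (slotsTOfRecord F N θ.ν θ.τ9 (EOfRecord₁₃ F N θ.toStage13Params) (wOfRecord₉ F N θ.toStage9Params) θ.ppSel p
            (gOfRecord₁₃ F N θ.toStage13Params p) (k + 1) s = 0 ∨
          ∀ᵐ V' ∂fieldMeasure (F.P p.K) (k + 1) (SU N),
            chiSeqOfRecord F N θ.ν θ.τ9.M (gOfRecord₁₃ F N θ.toStage13Params p) p.K (k + 1) s V' ≠ 0 →
              slotsTOfRecord F N θ.ν θ.τ9 (EOfRecord₁₃ F N θ.toStage13Params) (wOfRecord₉ F N θ.toStage9Params) θ.ppSel p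
                  (gOfRecord₁₃ F N θ.toStage13Params p) (k + 1) s V' =
                sect2Slot F N (FluctV N) p.K (settingOfRecord₁₃ F N θ.toStage13Params p) (θ.rzAt p s) (WtOfRecord₁₃H F N θ p s) s
                  (t s.init) (Ek s.init) (UbgOfRecord₁₃CoP F N θ.toStage13Params p (k + 1) s) V') := by
  obtain ⟨t, Ek, hform, hloc, hstep⟩ := exists_local_witness_clause_succ_of_sLaw₁₃CoPH_of_rows θ p h (zhUnity_of_gaussCert θ hζ) hk hM hS
  refine ⟨t, Ek, hform, hloc, fun s hΩ hΦ => ?_⟩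
  exact hstep s hΩ (prefix_agree_of_gaussCert θ p hζ hq s hΩ) (ζ0_pin_of_gaussCert θ p hζ hk s hΩ) (quad_empty_pairCfgAt_of_gaussCert θ p hq s)
    (quad_local_of_gaussCert θ p hq s) (fun j Y => measurable_ζ0_of_gaussCert θ p hζ h s j Y) (fun j Λ' => measurable_quad_of_gaussCert θ p hq s j Λ')
    (afibre_rows_adm_of_coercive θ p s fun j => coercive_of_gaussCert θ p hq s j) hΦ

/-- **★★★ THE SAME IN def-T's TERM-ROW GRAMMAR** (dag-n11-w4's edition 2 `exists_local_witness_clause_succ_of_sLaw₁₃CoPH_of_coercive_of_termRows` of dag-n11-d's all-primitive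
edition p586165): for the Gaussian certificate class the 𝐓-image clause at EVERY no-expansion history asks ONLY def-T's six term rows (E ∕ R ∕ B of the witness measurable and
bounded at the embedded background).  Caveat (dag-n11-w4, l.(23:53Z)): like `rePinH`, a certificate with a RANGE value of `quad` serves the NO-EXPANSION analysis only — the
expansion children (`Sect3SupplyAt`) see print's `𝒬_j`; neither certificate is node00-def-K0b's value of record. [cite: Balaban1988Convergent, Theorem p.245, Thm 1 p.262, (3.24)–(3.25) p.270, (2.21)–(2.23) p.258, (2.27) p.259] -/
theorem exists_local_witness_clause_succ_of_sLaw₁₃CoPH_of_gaussCert_of_termRows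
    (hζ : ∀ (p : B12.RunParams) (n : ℕ) (Ω Λ : ℕ → Set (Site (F.P p.K) 0)), (θ.Zh p n Ω Λ).ζ0 = (ZhPinOfRecord₁₃ θ.toStage13Params p Ω Λ).ζ0)
    (hq : ∀ (p : B12.RunParams) (n : ℕ) (Ω Λ : ℕ → Set (Site (F.P p.K) 0)) (j : ℕ) (Λ' : Set (Site (F.P p.K) 0)) (ω : MultiCfg (F.P p.K) (SU N) (FluctV N)),
      (θ.Zh p n Ω Λ).quad j Λ' ω = ∑ b ∈ (Set.toFinite (bondsIn j (Λ'ᶜ ∩ Ω (j + 1)))).toFinset, ‖(ω j).2 b‖ ^ 2)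
    (h : θ.Provisos₁₃CoPH F N) {k : ℕ} (hk : k < p.K) (hM : 1 ≤ θ.τ9.M) (hS : SLaw₁₃CoPH F N θ p k) :
    ∃ (t : SeqOfRecord F θ.ν θ.τ9.M (gOfRecord₁₃ F N θ.toStage13Params p) p.K k → Sect2.TermValues (F.P p.K) (MatA N) (FluctV N) θ.τ9.M)
      (Ek : SeqOfRecord F θ.ν θ.τ9.M (gOfRecord₁₃ F N θ.toStage13Params p) p.K k → ℝ),
      HasSect2FormAtZS F N (FluctV N) p.K (settingOfRecord₁₃ F N θ.toStage13Params p) k (θ.rzAt p) (WtOfRecord₁₃H F N θ p)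
          (UbgOfRecord₁₃CoP F N θ.toStage13Params p k)
          (fun s₀ t₀ => Sect2.LawsRT (sect2TowerOfRecord F N (FluctV N) p.K (settingOfRecord₁₃ F N θ.toStage13Params p) (θ.rzAt p s₀) s₀ t₀)
            (settingOfRecord₁₃ F N θ.toStage13Params p).lf k)
          (slotsOfRecord F N θ.ν θ.τ9 (EOfRecord₁₃ F N θ.toStage13Params) (wOfRecord₉ F N θ.toStage9Params) θ.ppSel p
            (gOfRecord₁₃ F N θ.toStage13Params p) k) t Ek ∧
      (∀ s₀, IsFluctLocal k (t s₀)) ∧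
      ∀ (s : SeqOfRecord F θ.ν θ.τ9.M (gOfRecord₁₃ F N θ.toStage13Params p) p.K (k + 1)), s.Ω (k + 1) = ∅ →
        -- def-T: the term values of the witness at the parent history, READ AT THE EMBEDDED BACKGROUND, are measurable …
        (∀ (j : ℕ) (X : (Sect2.domSys (F.P p.K) θ.τ9.M j).Dom) (z : Site (F.P p.K) j) (g' : ℝ),
          Measurable (fun U : GaugeField (F.P p.K) 0 (SU N) => ((t s.init).E j X z g' (Sect2.ofBackgroundC (settingOfRecord₁₃ F N θ.toStage13Params p).ι U)).re)) →
        (∀ (j : ℕ) (X : (Sect2.domSys (F.P p.K) θ.τ9.M j).Dom),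
          Measurable (fun U : GaugeField (F.P p.K) 0 (SU N) => ((t s.init).R j X (Sect2.ofBackgroundC (settingOfRecord₁₃ F N θ.toStage13Params p).ι U)).re)) →
        (∀ (S' : ℕ → Set (Site (F.P p.K) 0)) (j : ℕ) (X : (Sect2.domSys (F.P p.K) θ.τ9.M j).Dom),
          Measurable (fun q : GaugeField (F.P p.K) 0 (SU N) × MSFluct (F.P p.K) (FluctV N) =>
            ((t s.init).B j X (Sect2.ofBackgroundC (settingOfRecord₁₃ F N θ.toStage13Params p).ι q.1) (S', q.2)).re)) →
        -- … and uniformly bounded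
        (∃ CE : ℝ, ∀ (j : ℕ) (X : (Sect2.domSys (F.P p.K) θ.τ9.M j).Dom) (z : Site (F.P p.K) j) (g' : ℝ) (U : GaugeField (F.P p.K) 0 (SU N)),
          |((t s.init).E j X z g' (Sect2.ofBackgroundC (settingOfRecord₁₃ F N θ.toStage13Params p).ι U)).re| ≤ CE) →
        (∃ CR : ℝ, ∀ (j : ℕ) (X : (Sect2.domSys (F.P p.K) θ.τ9.M j).Dom) (U : GaugeField (F.P p.K) 0 (SU N)),
          |((t s.init).R j X (Sect2.ofBackgroundC (settingOfRecord₁₃ F N θ.toStage13Params p).ι U)).re| ≤ CR) →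
        (∃ CB : ℝ, ∀ (j : ℕ) (X : (Sect2.domSys (F.P p.K) θ.τ9.M j).Dom) (U : GaugeField (F.P p.K) 0 (SU N)) (a : Tk.SFluct (F.P p.K) (FluctV N)),
          |((t s.init).B j X (Sect2.ofBackgroundC (settingOfRecord₁₃ F N θ.toStage13Params p).ι U) a).re| ≤ CB) →
        (slotsTOfRecord F N θ.ν θ.τ9 (EOfRecord₁₃ F N θ.toStage13Params) (wOfRecord₉ F N θ.toStage9Params) θ.ppSel p
            (gOfRecord₁₃ F N θ.toStage13Params p) (k + 1) s = 0 ∨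
          ∀ᵐ V' ∂fieldMeasure (F.P p.K) (k + 1) (SU N),
            chiSeqOfRecord F N θ.ν θ.τ9.M (gOfRecord₁₃ F N θ.toStage13Params p) p.K (k + 1) s V' ≠ 0 →
              slotsTOfRecord F N θ.ν θ.τ9 (EOfRecord₁₃ F N θ.toStage13Params) (wOfRecord₉ F N θ.toStage9Params) θ.ppSel p
                  (gOfRecord₁₃ F N θ.toStage13Params p) (k + 1) s V' =
                sect2Slot F N (FluctV N) p.K (settingOfRecord₁₃ F N θ.toStage13Params p) (θ.rzAt p s) (WtOfRecord₁₃H F N θ p s) s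
                  (t s.init) (Ek s.init) (UbgOfRecord₁₃CoP F N θ.toStage13Params p (k + 1) s) V') := by
  obtain ⟨t, Ek, hform, hloc, H⟩ := exists_local_witness_clause_succ_of_sLaw₁₃CoPH_of_coercive_of_termRows θ p h (zhUnity_of_gaussCert θ hζ) hk hM hS
  exact ⟨t, Ek, hform, hloc, fun s hΩ hE hR hB hEb hRb hBb =>
    H s hΩ (prefix_agree_of_gaussCert θ p hζ hq s hΩ) (ζ0_pin_of_gaussCert θ p hζ hk s hΩ) (quad_empty_pairCfgAt_of_gaussCert θ p hq s)
      (quad_local_of_gaussCert θ p hq s) (fun j Y => measurable_ζ0_of_gaussCert θ p hζ h s j Y) (fun j Λ' => measurable_quad_of_gaussCert θ p hq s j Λ')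
      (coercive_of_gaussCert θ p hq s) hE hR hB hEb hRb hBb⟩

/-- **★★ HENCE dag-n11-e's DELIVERABLE `NoExpansionTStepAt θ p k` FOR THE CLASS FROM def-T's OPERAND ROWS ALONE** (asked for every k-local exposed witness of
`ρ_k`'s §2 form at every no-expansion history, as in `…N11NoExpansionTStepAtRePinH`, but WITHOUT the (K0b) rows). [cite: Balaban1988Convergent, Theorem p.245, (3.24)–(3.25) p.270, (2.23) p.258] -/
theorem noExpansionTStepAt_of_gaussCert_of_operandRows
    (hζ : ∀ (p : B12.RunParams) (n : ℕ) (Ω Λ : ℕ → Set (Site (F.P p.K) 0)), (θ.Zh p n Ω Λ).ζ0 = (ZhPinOfRecord₁₃ θ.toStage13Params p Ω Λ).ζ0)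
    (hq : ∀ (p : B12.RunParams) (n : ℕ) (Ω Λ : ℕ → Set (Site (F.P p.K) 0)) (j : ℕ) (Λ' : Set (Site (F.P p.K) 0)) (ω : MultiCfg (F.P p.K) (SU N) (FluctV N)),
      (θ.Zh p n Ω Λ).quad j Λ' ω = ∑ b ∈ (Set.toFinite (bondsIn j (Λ'ᶜ ∩ Ω (j + 1)))).toFinset, ‖(ω j).2 b‖ ^ 2)
    (h : θ.Provisos₁₃CoPH F N) {k : ℕ} (hk : k < p.K) (hM : 1 ≤ θ.τ9.M)
    (hops : ∀ (t : SeqOfRecord F θ.ν θ.τ9.M (gOfRecord₁₃ F N θ.toStage13Params p) p.K k → Sect2.TermValues (F.P p.K) (MatA N) (FluctV N) θ.τ9.M)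
      (Ek : SeqOfRecord F θ.ν θ.τ9.M (gOfRecord₁₃ F N θ.toStage13Params p) p.K k → ℝ),
      HasSect2FormAtZS F N (FluctV N) p.K (settingOfRecord₁₃ F N θ.toStage13Params p) k (θ.rzAt p) (WtOfRecord₁₃H F N θ p)
        (UbgOfRecord₁₃CoP F N θ.toStage13Params p k)
        (fun s u => Sect2.LawsRT (sect2TowerOfRecord F N (FluctV N) p.K (settingOfRecord₁₃ F N θ.toStage13Params p) (θ.rzAt p s) s u)
          (settingOfRecord₁₃ F N θ.toStage13Params p).lf k)
        (slotsOfRecord F N θ.ν θ.τ9 (EOfRecord₁₃ F N θ.toStage13Params) (wOfRecord₉ F N θ.toStage9Params) θ.ppSel p (gOfRecord₁₃ F N θ.toStage13Params p) k) t Ek →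
      (∀ s₀, IsFluctLocal k (t s₀)) →
      ∀ s : SeqOfRecord F θ.ν θ.τ9.M (gOfRecord₁₃ F N θ.toStage13Params p) p.K (k + 1), s.Ω (k + 1) = ∅ →
        ∀ S ∈ admSOfRecord F θ.ν θ.τ9.M (gOfRecord₁₃ F N θ.toStage13Params p) p.K k s.init,
          Measurable (fun ω : MultiCfg (F.P p.K) (SU N) (FluctV N) =>
            sect2Operand F N (FluctV N) p.K (settingOfRecord₁₃ F N θ.toStage13Params p) (θ.rzAt p s.init) s.init (t s.init) (Ek s.init)
                (UbgOfRecord₁₃CoP F N θ.toStage13Params p k s.init) (S, fun j => (ω j).2) (fun j => (ω j).1)) ∧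
          ∃ CΦ : ℝ, ∀ a U, sect2Operand F N (FluctV N) p.K (settingOfRecord₁₃ F N θ.toStage13Params p) (θ.rzAt p s.init) s.init (t s.init) (Ek s.init)
                (UbgOfRecord₁₃CoP F N θ.toStage13Params p k s.init) a U ≤ CΦ) :
    NoExpansionTStepAt θ p k := by
  intro hS
  obtain ⟨t, Ek, hform, hloc, hstep⟩ := exists_local_witness_clause_succ_of_sLaw₁₃CoPH_of_gaussCert θ p hζ hq h hk hM hS
  exact ⟨t, Ek, hform, fun s hΩ => hstep s hΩ (hops t Ek hform hloc s hΩ)⟩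

end Step

/-! ## §3  ★★ The class is inhabited from every parameter carrying the K⁷ antecedent, which transfers -/

section Transfer

variable (θ : Stage13HParams F N)

/-- **★★ THE GAUSSIAN CERTIFICATE OF A PARAMETER CARRIES THE K⁷ ANTECEDENT WHENEVER THE PARAMETER DOES** (A6 + transfer, as dag-n11-d's `antecedent_rePinH`): replace the
history-indexed residual slot `Zh` of `θ` by (certificate `ζ0`, Gaussian `quad`), keep everything else; every row of `Provisos₁₃SepCoPH` reads the Stage-13R part except
`zhLaws`∕`zhLocal`, which read `ζ0` only (dag-n11-d's `laws_∕localLaws_ZhPinOfRecord₁₃`); `ZhUnity` holds for the certificate `ζ0`; `SlotsNondegenerate₁₃` and `Admissible`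
read the Stage-13 part.  So the line of record may re-pin to the Gaussian certificate at no cost, and gains §2.
[cite: Balaban1988Convergent, Thm 1 p.262, (2.21) p.258, (3.16)–(3.22) pp.268–269; Balaban1987RG1, (1.4)–(1.5) pp.260–261] -/
theorem exists_gaussCert_of_antecedent (hP : θ.Provisos₁₃SepCoPH F N) (hnd : θ.SlotsNondegenerate₁₃ F N) (hadm : θ.Admissible F N) :
    ∃ θ' : Stage13HParams F N, θ'.toStage13RParams = θ.toStage13RParams ∧ θ'.Phih = θ.Phih ∧
      (∀ (p : B12.RunParams) (n : ℕ) (Ω Λ : ℕ → Set (Site (F.P p.K) 0)), (θ'.Zh p n Ω Λ).ζ0 = (ZhPinOfRecord₁₃ θ'.toStage13Params p Ω Λ).ζ0) ∧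
      (∀ (p : B12.RunParams) (n : ℕ) (Ω Λ : ℕ → Set (Site (F.P p.K) 0)) (j : ℕ) (Λ' : Set (Site (F.P p.K) 0)) (ω : MultiCfg (F.P p.K) (SU N) (FluctV N)),
        (θ'.Zh p n Ω Λ).quad j Λ' ω = ∑ b ∈ (Set.toFinite (bondsIn j (Λ'ᶜ ∩ Ω (j + 1)))).toFinset, ‖(ω j).2 b‖ ^ 2) ∧
      θ'.Provisos₁₃SepCoPH F N ∧ (θ'.ZhUnity F N ∧ θ'.SlotsNondegenerate₁₃ F N) ∧ θ'.Admissible F N := by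
  refine ⟨⟨θ.toStage13RParams,
      fun p _ Ω Λ => ⟨(ZhPinOfRecord₁₃ θ.toStage13Params p Ω Λ).ζ0,
        fun j Λ' ω => ∑ b ∈ (Set.toFinite (bondsIn j (Λ'ᶜ ∩ Ω (j + 1)))).toFinset, ‖(ω j).2 b‖ ^ 2⟩, θ.Phih⟩,
    rfl, rfl, fun _ _ _ _ => rfl, fun _ _ _ _ _ _ _ => rfl, ?_, ⟨?_, hnd⟩, hadm⟩
  · exact
      { intPiece := hP.intPiece
        measω := hP.measω
        measChi := hP.measChi
        zetaUnity := hP.zetaUnity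
        zetaAbs := hP.zetaAbs
        rstep := fun p k _ hk => hP.rstep p k hk
        rzLaws := hP.rzLaws
        zhLaws := fun p _ Ω Λ => ⟨(laws_ZhPinOfRecord₁₃ (θ := θ.toStage13Params) (p := p) hP.zetaUnity Ω Λ).zeta0_nonneg⟩
        zhLocal := fun p _ Ω Λ => ⟨(localLaws_ZhPinOfRecord₁₃ (θ := θ.toStage13Params) (p := p) Ω Λ).zeta0_local⟩
        hM := hP.hM
        hM₁ := hP.hM₁
        bg := hP.bg }
  · intro p n Ω Λ j ω
    exact zhUnity_rePinH (θ := θ) p n Ω Λ j ω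

end Transfer

end Summit.QuantumFields.YangMills.Theorems.BalabanUVNodesN11GaussianCertificateRows

end
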